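import Summits.CriticalPhenomena.SAWScalingLimit.Theorems.SAWLoopFugacityFlowAvoidanceLimitNestedGermArcs
import HarnessLib

/-!
# Nested germ arcs at three scales

Sub-problem `CriticalPhenomena/SAWScalingLimit`, crux `AvoidanceLimit`, line `symplectic-fermion-anchor`
(lead c7), stub `stub_germTwoSided`, hub existence (crux NOTES.md §"hcore blueprint (lead c6)" §7, the
TB-transversal along the intermediate gate). For three scales `s < t < s'` (same base point `g` in the small
box, same far point `o` off the big closed box) and nested germ arcs `σ' < θ₁ < θ₂ < τ' < σ' + 1` of the pair
`(s, s')` (`exists_nested_germArcs`: `∂U(s') = gateArc(s') ∪ D.boundary '' [σ', τ']`,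
`∂U(s) = gateArc(s) ∪ D.boundary '' [θ₁, θ₂]`, with the identification of the arc ends with the gate ends),
the germ region at the intermediate scale has `∂U(t) = gateArc(t) ∪ D.boundary '' [φ₁, φ₂]` with
`σ' < φ₁ < θ₁` and `θ₂ < φ₂ < τ'` IN THE SAME PARAMETRISATION: the two ends of the intermediate gate lie on the
interiors of the two lateral arcs `D.boundary '' [σ', θ₁]` and `D.boundary '' [θ₂, τ']`. Proof: two
applications of `exists_nested_germArcs` (to `(s, t)` and to `(t, s')`) and the rigidity of parameter
windows of length `< 1` under `D.boundary` (injective on every `[a, a + 1)`, `D.injOn_boundary_Ico`).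

* `image_boundary_Icc_subset_of_union_eq` — two descriptions `gateArc ∪ ∂D[σ, τ] = gateArc ∪ ∂D[σ₂, τ₂]`
  of one frontier, with the gate ends on the second arc, give `∂D[σ, τ] ⊆ ∂D[σ₂, τ₂]`;
* `exists_int_shift_of_arc_eq` — equal closed boundary arcs of parameter length `< 1` with equal
  end-point sets have parameters differing by a common integer;
* `threeScale_germArcs` — the statement above.

[cite: Chelkak2016, §3.2 (truncated domains and their boundary arcs)]
-/

noncomputable section

open scoped Classical Topology
open Set Metric Filter
open Literature.Topology.PlaneTopology
open Literature.Probability.LatticeModels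
open Literature.Probability.RandomPlanarGeometry (JordanDomain)

namespace Summit.CriticalPhenomena.SAWScalingLimit.Theorems.AvoidanceLimit.Anchor

/-! ### Rigidity of boundary arcs -/

/-- **Comparing two descriptions of the same frontier.** If `gateArc ∪ ∂D[σ, τ] = gateArc ∪ ∂D[σ₂, τ₂]`
and the two gate ends are `D.boundary σ₂`, `D.boundary τ₂` (`σ₂ ≤ τ₂`), then `∂D[σ, τ] ⊆ ∂D[σ₂, τ₂]`:
a point of `∂D[σ, τ]` on the gate arc is off `D`, hence not on the open gate, hence a gate end.
[folklore] -/
theorem image_boundary_Icc_subset_of_union_eq {D Q : JordanDomain} {t₀ σ τ σ₂ τ₂ : ℝ}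
    (hστ₂ : σ₂ ≤ τ₂)
    (hU : gateArc D Q t₀ ∪ D.boundary '' Set.Icc σ τ = gateArc D Q t₀ ∪ D.boundary '' Set.Icc σ₂ τ₂)
    (hends : ({D.boundary σ₂, D.boundary τ₂} : Set ℂ) =
      {Q.boundary (gateLo D Q t₀), Q.boundary (gateHi D Q t₀)}) :
    D.boundary '' Set.Icc σ τ ⊆ D.boundary '' Set.Icc σ₂ τ₂ := by
  -- the two gate ends lie on the target arc
  have hpair : ({D.boundary σ₂, D.boundary τ₂} : Set ℂ) ⊆ D.boundary '' Set.Icc σ₂ τ₂ := by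
    rintro z (rfl | rfl)
    · exact ⟨σ₂, left_mem_Icc.2 hστ₂, rfl⟩
    · exact ⟨τ₂, right_mem_Icc.2 hστ₂, rfl⟩
  have hlo : Q.boundary (gateLo D Q t₀) ∈ D.boundary '' Set.Icc σ₂ τ₂ :=
    hpair (by rw [hends]; exact mem_insert _ _)
  have hhi : Q.boundary (gateHi D Q t₀) ∈ D.boundary '' Set.Icc σ₂ τ₂ :=
    hpair (by rw [hends]; exact mem_insert_of_mem _ (mem_singleton _))
  rintro _ ⟨θ, hθ, rfl⟩
  have hz : D.boundary θ ∈ gateArc D Q t₀ ∪ D.boundary '' Set.Icc σ₂ τ₂ := by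
    rw [← hU]; exact Or.inr ⟨θ, hθ, rfl⟩
  rcases hz with ⟨ψ, hψ, hψeq⟩ | hz
  · rcases hψ.1.eq_or_lt with h₁ | h₁
    · rw [← hψeq, ← h₁]; exact hlo
    rcases hψ.2.eq_or_lt with h₂ | h₂
    · rw [← hψeq, h₂]; exact hhi
    · -- an interior gate point lies in `D`, a boundary point does not
      exact absurd (hψeq ▸ gate_subset_carrier t₀ ⟨ψ, ⟨h₁, h₂⟩, rfl⟩)
        fun h => Set.disjoint_left.1 D.disjoint_carrier_frontier h (D.boundary_mem_frontier θ)
  · exact hz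

/-- **Rigidity of parameter windows.** Two closed boundary arcs `∂D[σ, τ]` (`σ < τ < σ + 1`) and
`∂D[σ₂, τ₂]` (`σ₂ < τ₂ < σ₂ + 1`) that coincide as sets and have the same end-point sets have
parameters differing by a common integer: `σ₂ = σ + k`, `τ₂ = τ + k`. (Equal ends give integer
shifts of each end separately, equalised by the window lengths `< 1`; swapped ends would make
`∂D[σ₂, τ₂]` the complementary arc `∂D[τ, σ + 1]`, which misses the point `D.boundary ((σ + τ)/2)`
by injectivity of the loop on a period.) [folklore] -/
theorem exists_int_shift_of_arc_eq (D : JordanDomain) {σ τ σ₂ τ₂ : ℝ} (hστ : σ < τ)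
    (hτσ : τ < σ + 1) (hστ₂ : σ₂ < τ₂) (hτσ₂ : τ₂ < σ₂ + 1)
    (harc : D.boundary '' Set.Icc σ₂ τ₂ = D.boundary '' Set.Icc σ τ)
    (hends : ({D.boundary σ₂, D.boundary τ₂} : Set ℂ) = {D.boundary σ, D.boundary τ}) :
    ∃ k : ℤ, σ₂ = σ + k ∧ τ₂ = τ + k := by
  rcases Set.pair_eq_pair_iff.1 hends with ⟨h₁, h₂⟩ | ⟨h₁, h₂⟩
  · -- same ends: the two integer shifts agree
    obtain ⟨k, hk⟩ := D.exists_int_eq_add_of_boundary_eq h₁.symm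
    obtain ⟨m, hm⟩ := D.exists_int_eq_add_of_boundary_eq h₂.symm
    have e₁ : (m : ℝ) < k + 1 := by linarith
    have e₂ : (k : ℝ) < m + 1 := by linarith
    have e₁' : m < k + 1 := by exact_mod_cast e₁
    have e₂' : k < m + 1 := by exact_mod_cast e₂
    have hmk : m = k := by omega
    subst hmk
    exact ⟨m, hk, hm⟩
  · -- swapped ends: the mid-point of `[σ, τ]` is not on `∂D[σ₂, τ₂]`
    exfalso
    obtain ⟨k, hk⟩ := D.exists_int_eq_add_of_boundary_eq h₁.symm
    obtain ⟨m, hm⟩ := D.exists_int_eq_add_of_boundary_eq h₂.symm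
    have hmid : D.boundary ((σ + τ) / 2) ∈ D.boundary '' Set.Icc σ₂ τ₂ := by
      rw [harc]; exact ⟨(σ + τ) / 2, ⟨by linarith, by linarith⟩, rfl⟩
    obtain ⟨ψ, hψ, hψeq⟩ := hmid
    obtain ⟨j, hj⟩ := D.exists_int_eq_add_of_boundary_eq hψeq
    have hψ₁ := hψ.1
    have hψ₂ := hψ.2
    have f₁ : ((j : ℝ) + k) < 0 := by linarith
    have f₂ : (0 : ℝ) < m + j := by linarith
    have f₃ : (m : ℝ) < k + 2 := by linarith
    have f₁' : j + k < 0 := by exact_mod_cast f₁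
    have f₂' : 0 < m + j := by exact_mod_cast f₂
    have f₃' : m < k + 2 := by exact_mod_cast f₃
    omega

/-! ### The three scales -/

/-- **Nested germ arcs at three scales.** See the module docstring. [folklore] -/
theorem threeScale_germArcs :
    ∀ (D : JordanDomain) (b : ℂ) (s t s' : ℝ) (hs : 0 < s) (ht : 0 < t) (hs' : 0 < s'), s < t → t < s' →
    ∀ (g o : ℂ), TwoOff D (boxJD b hs) → TwoOff D (boxJD b ht) → TwoOff D (boxJD b hs') →
      g ∈ D.carrier ∩ Literature.Topology.PlaneTopology.box b s → o ∈ D.carrier → o ∉ closedBox b s' →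
    ∀ (σ' θ₁ θ₂ τ' : ℝ), σ' < θ₁ → θ₁ < θ₂ → θ₂ < τ' → τ' < σ' + 1 →
      frontier (germRegion D b hs' g o) =
        gateArc D (boxJD b hs') (germGateParam D b hs' g o) ∪ D.boundary '' Set.Icc σ' τ' →
      frontier (germRegion D b hs g o) =
        gateArc D (boxJD b hs) (germGateParam D b hs g o) ∪ D.boundary '' Set.Icc θ₁ θ₂ →
      ({D.boundary θ₁, D.boundary θ₂} : Set ℂ) =
        {(boxJD b hs).boundary (gateLo D (boxJD b hs) (germGateParam D b hs g o)),
         (boxJD b hs).boundary (gateHi D (boxJD b hs) (germGateParam D b hs g o))} →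
      ({D.boundary σ', D.boundary τ'} : Set ℂ) =
        {(boxJD b hs').boundary (gateLo D (boxJD b hs') (germGateParam D b hs' g o)),
         (boxJD b hs').boundary (gateHi D (boxJD b hs') (germGateParam D b hs' g o))} →
    ∃ φ₁ φ₂ : ℝ, σ' < φ₁ ∧ φ₁ < θ₁ ∧ θ₂ < φ₂ ∧ φ₂ < τ' ∧
      frontier (germRegion D b ht g o) =
        gateArc D (boxJD b ht) (germGateParam D b ht g o) ∪ D.boundary '' Set.Icc φ₁ φ₂ ∧
      ({D.boundary φ₁, D.boundary φ₂} : Set ℂ) =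
        {(boxJD b ht).boundary (gateLo D (boxJD b ht) (germGateParam D b ht g o)),
         (boxJD b ht).boundary (gateHi D (boxJD b ht) (germGateParam D b ht g o))} := by
  intro D b s t s' hs ht hs' hst hts' g o h2s h2t h2s' hg ho hoc σ' θ₁ θ₂ τ' hσθ hθθ hθτ hτσ hF' hF hE hE'
  have hgt : g ∈ D.carrier ∩ Literature.Topology.PlaneTopology.box b t :=
    ⟨hg.1, Literature.Topology.PlaneTopology.box_mono hst.le hg.2⟩
  have hoct : o ∉ closedBox b t := fun h => hoc (closedBox_mono hts'.le h)
  have hper : ∀ (θ : ℝ) (k : ℤ), D.boundary (θ + k) = D.boundary θ := fun θ k => by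
    simpa using D.periodic_boundary.int_mul k θ
  -- (1) nested arcs of the pair `(t, s')`
  obtain ⟨σ₂, φ₁, φ₂, τ₂, h₁, h₂, h₃, h₄, hF'₂, hFt, hEt, hE'₂⟩ :=
    exists_nested_germArcs D b t s' ht hs' hts' g o h2t h2s' hgt ho hoc
  -- (2) rigidity at the scale `s'`: `σ₂ = σ' + k`, `τ₂ = τ' + k`
  have hA : D.boundary '' Set.Icc σ₂ τ₂ = D.boundary '' Set.Icc σ' τ' :=
    Subset.antisymm
      (image_boundary_Icc_subset_of_union_eq (by linarith) (hF'₂.symm.trans hF') hE')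
      (image_boundary_Icc_subset_of_union_eq (by linarith) (hF'.symm.trans hF'₂) hE'₂)
  obtain ⟨k, hk₁, hk₂⟩ := exists_int_shift_of_arc_eq D (by linarith) hτσ (by linarith) h₄ hA
    (hE'₂.trans hE'.symm)
  -- (3) nested arcs of the pair `(s, t)`
  obtain ⟨σ₁, a₁, a₂, τ₁, g₁, g₂, g₃, g₄, hFt₁, hF₁, hE₁, hEt₁⟩ :=
    exists_nested_germArcs D b s t hs ht hst g o h2s h2t hg ho hoct
  -- rigidity at the scale `s`: `a₁ = θ₁ + k'`, `a₂ = θ₂ + k'`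
  have hB : D.boundary '' Set.Icc a₁ a₂ = D.boundary '' Set.Icc θ₁ θ₂ :=
    Subset.antisymm
      (image_boundary_Icc_subset_of_union_eq hθθ.le (hF₁.symm.trans hF) hE)
      (image_boundary_Icc_subset_of_union_eq g₂.le (hF.symm.trans hF₁) hE₁)
  obtain ⟨k', hk'₁, hk'₂⟩ := exists_int_shift_of_arc_eq D hθθ (by linarith) g₂ (by linarith) hB
    (hE₁.trans hE.symm)
  -- rigidity at the scale `t`: `σ₁ = φ₁ + k''`, `τ₁ = φ₂ + k''`
  have hC : D.boundary '' Set.Icc σ₁ τ₁ = D.boundary '' Set.Icc φ₁ φ₂ :=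
    Subset.antisymm
      (image_boundary_Icc_subset_of_union_eq h₂.le (hFt₁.symm.trans hFt) hEt)
      (image_boundary_Icc_subset_of_union_eq (by linarith) (hFt.symm.trans hFt₁) hEt₁)
  obtain ⟨k'', hk''₁, hk''₂⟩ := exists_int_shift_of_arc_eq D h₂ (by linarith) (by linarith) g₄ hC
    (hEt₁.trans hEt.symm)
  -- (4) integer bookkeeping: `θ₁ + k' - k''` and `θ₁ + k` lie in the same period `(σ₂, σ₂ + 1)`
  have hint : k' = k'' + k := by
    have e₁ : (k' : ℝ) < k'' + k + 1 := by linarith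
    have e₂ : (k'' : ℝ) + k < k' + 1 := by linarith
    have e₁' : k' < k'' + k + 1 := by exact_mod_cast e₁
    have e₂' : k'' + k < k' + 1 := by exact_mod_cast e₂
    omega
  have hint' : (k' : ℝ) = k'' + k := by exact_mod_cast hint
  refine ⟨φ₁ - k, φ₂ - k, by linarith, by linarith, by linarith, by linarith, ?_, ?_⟩
  · rw [show φ₁ - k = φ₁ + ((-k : ℤ) : ℝ) by push_cast; ring,
      show φ₂ - k = φ₂ + ((-k : ℤ) : ℝ) by push_cast; ring, image_boundary_Icc_add_int]
    exact hFt
  · rw [show φ₁ - k = φ₁ + ((-k : ℤ) : ℝ) by push_cast; ring,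
      show φ₂ - k = φ₂ + ((-k : ℤ) : ℝ) by push_cast; ring, hper, hper]
    exact hEt

end Summit.CriticalPhenomena.SAWScalingLimit.Theorems.AvoidanceLimit.Anchor

end
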